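import Mathlib
import Literature.NumberTheory.LFunctions.Zhang2022.AppendixALemma152StepsS
import Literature.NumberTheory.LFunctions.MertensElementary
import Literature.NumberTheory.LFunctions.Zhang2022.AppendixALemma83Kappa
import HarnessLib

/-!
# Zhang (2022), Appendix A part 2 (v): the deduction node `Lem152_pf` — Lemma 15.2 from (A.4), (A.5), u021, (A.6), (A.7) — kernel-checked

Topic `Literature/NumberTheory/LFunctions/Zhang2022` (Landau–Siegel audit tree; verdict-neutral).
Y. Zhang, *Discrete mean estimates and the Landau–Siegel zero*, arXiv:2211.02515v1 (2022)
[Zhang2022LandauSiegel] — **an unrefereed manuscript under adjudication**. The cell's typed node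
`Typed.AppendixA2.Lem152_pf c′ := EqA4 c′ → EqA5 c′ → StepA_u021 c′ → EqA6 c′ → EqA7 c′ → Lemma152I c′`
(the manuscript's "By (A.4), (A.5) and the relations … it suffices to show (A.6) … and (A.7)", App. A
p. 103) is PROVED here: `lem152_pf_holds`. Since (A.5), u021a (tree), u021b, (A.6), (A.7) (this
series of files) are themselves kernel-checked, the only remaining hypothesis of Lemma 15.2 in the
kernel is **(A.4)** — the Euler-product representation of `ℳ₁` with tail `1 + O(D^{−c})`, an
analytic claim of the manuscript (`lemma152_of_eqA4`).

This file: the threshold facts (Mertens `Σ_{p<D} log p/p ≤ 2𝓛`, `1 < P₂`, the absorption of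
(A.4)'s `D^{−c}` and of the Euler-product tail `O(1/D)` into `O(α𝓛) = O(𝓛⁻⁸)` for `D ≥ D₀(c, C, c′)`)
and the assembly `lem152_pf_holds`; the per-prime estimate, the finite-product perturbation and the
tail estimate are the companion `AppendixALemma152Prep.lean`'s.

## References

* Y. Zhang, arXiv:2211.02515v1 (2022), Appendix A pp. 103–104; §15 Lemma 15.2 p. 87.
  [cite: Zhang2022LandauSiegel, Appendix A, Lemma 15.2]
* G. H. Hardy, E. M. Wright, *An Introduction to the Theory of Numbers*, Thm 425. [HardyWright2008]
-/

noncomputable section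

open Finset Real Complex ArithmeticFunction Filter Topology

namespace Literature.NumberTheory.LFunctions.Zhang2022.AppendixALocal

open MeanSquareMajorant (powI kappa₁)
open Skeleton (ell alpha bigP b1 b2 beta1 beta2 nset ForAllLarge)
-- OBJECTS: the §15 objects of `Typed.AppendixA2` are the imported `Typed.Section15A/15B/15C` ones
-- (merge revision p414212); `sumA6`, `zetaFactor1` are `Typed.AppendixA2`'s own.
open Typed.Section15A (kappa1 kappaTilde1 lam1)
open Typed.Section15B (xi1 lamTilde1 xi1LocalSeries calM1Factor calM1)
open Typed.Section15C (eulerM1)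
open Typed.AppendixA2 (sumA6 zetaFactor1)

/-! ### §6. Threshold facts for the assembly -/

/-- `1 < P₂` (indeed `log P₂ = 𝓛⁹/2 − 10𝓛^{1.1} > 0`) once `𝓛 ≥ 2`, so that (A.4) applies at
`d = l = 1` (`dl = 1 < P₂²`). [cite: Zhang2022LandauSiegel, §2 (2.21)] -/
theorem one_lt_P2 {D : ℕ} (hℓ : 2 ≤ ell D) : 1 < Skeleton.P2 D := by
  have hℓ1 : 1 ≤ ell D := by linarith
  have e : Skeleton.P2 D = Real.exp (ell D ^ 9 * 0.5 - (10 : ℕ) * ell D ^ (1.1 : ℝ)) := by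
    rw [Skeleton.P2, Skeleton.bigP, Skeleton.bigT, ← Real.exp_mul, ← Real.exp_nat_mul, Real.exp_sub]
  rw [e, Real.one_lt_exp_iff]
  have h11 : ell D ^ (1.1 : ℝ) ≤ ell D ^ (2 : ℝ) :=
    Real.rpow_le_rpow_of_exponent_le hℓ1 (by norm_num)
  rw [Real.rpow_two] at h11
  have h7 : (2 : ℝ) ^ 7 ≤ ell D ^ 7 := pow_le_pow_left₀ (by norm_num) hℓ 7
  push_cast
  nlinarith [pow_pos (by linarith : (0:ℝ) < ell D) 2]

/-- `16! ≤ 10¹⁴`. [cite: Zhang2022LandauSiegel, App. A (A.4) p. 103] -/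
theorem factorial_sixteen_le : (Nat.factorial 16 : ℝ) ≤ 10 ^ 14 := by
  have : Nat.factorial 16 = 20922789888000 := by decide
  rw [this]; norm_num

/-- `x¹⁶/10¹⁴ ≤ eˣ` for `x ≥ 0` (`eˣ ≥ x¹⁶/16!`). [cite: Zhang2022LandauSiegel, App. A (A.4) p. 103] -/
theorem pow_sixteen_le_exp {x : ℝ} (hx : 0 ≤ x) : x ^ 16 / 10 ^ 14 ≤ Real.exp x := by
  have h := Real.pow_div_factorial_le_exp x hx 16
  have hf : (0 : ℝ) < Nat.factorial 16 := by exact_mod_cast Nat.factorial_pos 16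
  calc x ^ 16 / 10 ^ 14 ≤ x ^ 16 / Nat.factorial 16 :=
        div_le_div_of_nonneg_left (by positivity) hf factorial_sixteen_le
    _ ≤ Real.exp x := h

/-- **`D^{−c} ≤ 10¹⁴/(c𝓛)¹⁶`** (`D = e^𝓛`, `eˣ ≥ x¹⁶/10¹⁴`): the absorption of (A.4)'s `O(D^{−c})`.
[cite: Zhang2022LandauSiegel, App. A (A.4) p. 103] -/
theorem rpow_neg_le {D : ℕ} (hD : 0 < D) {c : ℝ} (hc : 0 < c) (hℓ : 0 < ell D) :
    (D : ℝ) ^ (-c) ≤ 10 ^ 14 / (c * ell D) ^ 16 := by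
  have hD0 : (0 : ℝ) < D := by exact_mod_cast hD
  rw [Real.rpow_def_of_pos hD0, show Real.log (D : ℝ) = ell D from rfl,
    show ell D * -c = -(c * ell D) by ring, Real.exp_neg]
  have hx : 0 < c * ell D := mul_pos hc hℓ
  have h := pow_sixteen_le_exp (le_of_lt hx)
  rw [inv_eq_one_div, div_le_div_iff₀ (Real.exp_pos _) (by positivity), one_mul]
  rw [div_le_iff₀ (by positivity)] at h
  linarith

/-- `Σ_{q<D, q prime} log q/q ≤ 𝓛 + log 4 ≤ 2𝓛` (`𝓛 ≥ 2`; Mertens, tree `MertensBound.sum_log_div_prime_le`).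
[cite: HardyWright2008, Thm 425] -/
theorem sum_log_div_le {D : ℕ} (hℓ : 2 ≤ ell D) :
    ∑ q ∈ (Finset.range D).filter Nat.Prime, Real.log q / q ≤ 2 * ell D := by
  have h := MertensBound.sum_log_div_prime_le D
  have hsub : (Finset.range D).filter Nat.Prime ⊆ Nat.primesLE D := by
    intro q hq
    rw [Nat.primesLE_eq_filter_range, mem_filter, mem_range]
    rw [mem_filter, mem_range] at hq
    exact ⟨by omega, hq.2⟩
  have hlog4 : Real.log 4 ≤ 2 := by
    have : Real.log 4 = 2 * Real.log 2 := by
      rw [show (4:ℝ) = 2^2 by norm_num, Real.log_pow]; norm_num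
    rw [this]; nlinarith [Real.log_two_lt_d9]
  calc ∑ q ∈ (Finset.range D).filter Nat.Prime, Real.log q / q
      ≤ ∑ q ∈ Nat.primesLE D, Real.log q / q :=
        sum_le_sum_of_subset_of_nonneg hsub (fun q _ _ =>
          div_nonneg (Real.log_natCast_nonneg q) (Nat.cast_nonneg q))
    _ ≤ Real.log D + Real.log 4 := h
    _ ≤ 2 * ell D := by rw [show Real.log (D:ℝ) = ell D from rfl]; linarith

/-- The perturbation constants are small: `2Kα𝓛 ≤ 1` and `84Kα𝓛 ≤ 1` once `𝓛 ≥ max(32, 100Kπ)`.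
[cite: Zhang2022LandauSiegel, App. A p. 103] -/
theorem absorb_pert {D : ℕ} {K : ℝ} (hK1 : 1 ≤ K) (hℓ32 : 32 ≤ ell D) (hKℓ : 100 * K * π ≤ ell D) :
    2 * K * (alpha D * ell D) ≤ 1 ∧ 84 * K * (alpha D * ell D) ≤ 1 := by
  have hℓ1 : 1 ≤ ell D := by linarith
  have hℓ0 : 0 < ell D := by linarith
  rw [Lemma83.alpha_mul_ell hℓ0.ne']
  have hℓ8 : ell D ≤ ell D ^ 8 := by
    calc ell D = ell D ^ 1 := (pow_one _).symm
      _ ≤ ell D ^ 8 := pow_le_pow_right₀ hℓ1 (by norm_num)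
  have hℓ28 : ell D ^ 2 ≤ ell D ^ 8 := pow_le_pow_right₀ hℓ1 (by norm_num)
  have h8 : 0 < ell D ^ 8 := by positivity
  constructor
  · rw [show 2 * K * (π / ell D ^ 8) = (2 * K * π) / ell D ^ 8 by ring, div_le_one h8]
    nlinarith [Real.pi_pos.le]
  · rw [show 84 * K * (π / ell D ^ 8) = (84 * K * π) / ell D ^ 8 by ring, div_le_one h8]
    have h2 : 84 * K * π ≤ ell D ^ 2 := by
      rw [sq]; nlinarith [Real.pi_gt_three, hK1, hℓ32]
    linarith

/-- Absorption of (A.4)'s `O(D^{−c})`: `22·C·D^{−c} ≤ α𝓛` once `𝓛 ≥ 8·10¹⁴C/c¹⁶` (`C ≥ 1`, `𝓛 ≥ 1`).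
[cite: Zhang2022LandauSiegel, App. A (A.4) p. 103] -/
theorem absorb_rpow {D : ℕ} (hD0 : 0 < D) {c C : ℝ} (hc : 0 < c) (hC : 1 ≤ C) (hℓ1 : 1 ≤ ell D)
    (hℓM : 8 * 10 ^ 14 * C / c ^ 16 ≤ ell D) :
    C * (D : ℝ) ^ (-c) * 22 ≤ alpha D * ell D := by
  have hℓ0 : 0 < ell D := by linarith
  have hrpow : (D : ℝ) ^ (-c) ≤ 10 ^ 14 / (c * ell D) ^ 16 := rpow_neg_le hD0 hc hℓ0
  have hC0 : 0 ≤ C := by linarith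
  calc C * (D : ℝ) ^ (-c) * 22 ≤ C * (10 ^ 14 / (c * ell D) ^ 16) * 22 := by gcongr
    _ ≤ alpha D * ell D := by
        rw [Lemma83.alpha_mul_ell hℓ0.ne']
        rw [show C * ((10:ℝ) ^ 14 / (c * ell D) ^ 16) * 22 =
            (22 * 10 ^ 14 * C) / (c ^ 16 * ell D ^ 8 * ell D ^ 8) by ring]
        rw [div_le_div_iff₀ (by positivity) (by positivity)]
        have hc16 : 0 < c ^ 16 := by positivity
        have hkey : 8 * 10 ^ 14 * C ≤ c ^ 16 * ell D := by
          rw [div_le_iff₀ hc16] at hℓM; linarith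
        have hπ3 : (3 : ℝ) ≤ π := by linarith [Real.pi_gt_three]
        have hℓ8 : ell D ≤ ell D ^ 8 := by
          calc ell D = ell D ^ 1 := (pow_one _).symm
            _ ≤ ell D ^ 8 := pow_le_pow_right₀ hℓ1 (by norm_num)
        have hℓ8pos : 0 < ell D ^ 8 := by positivity
        have h1 : 8 * 10 ^ 14 * C * ell D ^ 8 ≤ c ^ 16 * ell D ^ 8 * ell D ^ 8 := by
          have := mul_le_mul_of_nonneg_left hℓ8 hc16.le
          nlinarith
        have h2 := mul_le_mul hπ3 h1 (by positivity) (by linarith)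
        have h3 : 0 ≤ C * ell D ^ 8 := mul_nonneg hC0 hℓ8pos.le
        nlinarith

/-- Absorption of the Euler-product tail: `21(exp(2/(D−1)) − 1) ≤ α𝓛` once `𝓛 ≥ 28·10¹⁴` (`D ≥ 3`).
[cite: Zhang2022LandauSiegel, Lemma 15.2 p. 87] -/
theorem absorb_tail {D : ℕ} (hD3 : 3 ≤ D) (hℓ1 : 1 ≤ ell D) (hℓbig : (10:ℝ) ^ 14 * 28 ≤ ell D) :
    21 * (Real.exp (2 / ((D : ℝ) - 1)) - 1) ≤ alpha D * ell D := by
  have hD0 : 0 < D := by omega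
  have hℓ0 : 0 < ell D := by linarith
  have hD1r : (2 : ℝ) ≤ (D : ℝ) - 1 := by
    have : (3 : ℝ) ≤ D := by exact_mod_cast hD3
    linarith
  have ht0 : 0 ≤ 2 / ((D : ℝ) - 1) := by positivity
  have ht1 : 2 / ((D : ℝ) - 1) ≤ 1 := by rw [div_le_one (by linarith)]; linarith
  have hexp := Sieve.SquarefreeSums.exp_sub_one_le_two_mul ht0 ht1
  calc 21 * (Real.exp (2 / ((D : ℝ) - 1)) - 1) ≤ 21 * (2 * (2 / ((D : ℝ) - 1))) := by gcongr
    _ = 84 / ((D : ℝ) - 1) := by ring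
    _ ≤ alpha D * ell D := by
        rw [Lemma83.alpha_mul_ell hℓ0.ne', div_le_div_iff₀ (by linarith) (by positivity)]
        have hDexp : (D : ℝ) = Real.exp (ell D) := by
          rw [ell, Real.exp_log (by exact_mod_cast hD0)]
        have h16 := pow_sixteen_le_exp hℓ0.le
        rw [← hDexp, div_le_iff₀ (by positivity)] at h16
        have hℓ8 : ell D ≤ ell D ^ 8 := by
          calc ell D = ell D ^ 1 := (pow_one _).symm
            _ ≤ ell D ^ 8 := pow_le_pow_right₀ hℓ1 (by norm_num)
        have hπ3 : (3 : ℝ) ≤ π := by linarith [Real.pi_gt_three]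
        have hℓ8pos : 0 < ell D ^ 8 := by positivity
        have h1 : ell D ^ 8 * ((10:ℝ) ^ 14 * 28) ≤ ell D ^ 16 := by
          rw [show ell D ^ 16 = ell D ^ 8 * ell D ^ 8 by ring]
          exact mul_le_mul_of_nonneg_left (hℓbig.trans hℓ8) hℓ8pos.le
        have h28 : 28 * ell D ^ 8 ≤ (D : ℝ) := by linarith
        have hℓ8one : 1 ≤ ell D ^ 8 := one_le_pow₀ hℓ1
        have hπlo : (3.14 : ℝ) < π := Real.pi_gt_d2
        have hπhi : π < 3.15 := Real.pi_lt_d2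
        have hA := mul_le_mul_of_nonneg_left h28 Real.pi_pos.le
        have hB := mul_le_mul_of_nonneg_right hπlo.le hℓ8pos.le
        nlinarith

/-! ### §7. **The deduction node `Lem152_pf`, kernel-checked** -/

/-- The core of the deduction of Lemma 15.2: from (A.4), the pointwise form of (A.5) at `d = l = 1`,
`λ̃₁(q,1) = λ₁(q)`, u021b, (A.6) and (A.7), with the constant `84K + 2`, `K = 5C₁ + C₁C₂ + 3C₂` in
terms of the constants of u021b and (A.6)/(A.7); the threshold depends on `c′`, on these constants and
on the `c, C` of (A.4). [cite: Zhang2022LandauSiegel, App. A pp. 103–104 (proof of Lemma 15.2)] -/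
theorem lemma152_core (c' : ℝ) (h4 : Typed.AppendixA2.EqA4 c')
    (h5 : ∀ (D : ℕ) [NeZero D] (χ : DirichletCharacter ℂ D) (q r : ℕ), q.Prime → 1 ≤ r →
      xi1 c' χ (q ^ r) 1 1 =
        kappaTilde1 c' χ (q ^ r) 1 1 - χ (q : ZMod D) * (q : ℂ) / ((q : ℂ) - 1) * kappa1 c' D (q ^ (r - 1)))
    (h21a : ∀ (D : ℕ) [NeZero D] (χ : DirichletCharacter ℂ D) (q : ℕ), q.Prime →
      lamTilde1 c' χ q 1 = lam1 c' χ q 1)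
    (h21b : Typed.AppendixA2.StepA_u021b c') (h6 : Typed.AppendixA2.EqA6 c')
    (h7 : Typed.AppendixA2.EqA7 c') : Typed.Section15C.Lemma152I c' := by
  obtain ⟨c, hc, C4, D4, H4⟩ := h4
  obtain ⟨C1, D1, H1⟩ := h21b
  obtain ⟨C6, D6, H6⟩ := h6
  obtain ⟨C7, D7, H7⟩ := h7
  -- constants
  set C1' : ℝ := max C1 1 with hC1'
  set C2' : ℝ := max (max C6 C7) 1 with hC2'
  set K : ℝ := 5 * C1' + C1' * C2' + 3 * C2' with hK
  set C4' : ℝ := max C4 1 with hC4'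
  have hC1'1 : 1 ≤ C1' := le_max_right _ _
  have hC2'1 : 1 ≤ C2' := le_max_right _ _
  have hC4'1 : 1 ≤ C4' := le_max_right _ _
  have hK1 : 1 ≤ K := by rw [hK]; nlinarith
  -- threshold
  set M₀ : ℝ := 7 * π * |c'| + 32 + 100 * K * π + 8 * 10 ^ 14 * C4' / c ^ 16 +
    10 ^ 14 * 28 with hM₀
  set D₀ : ℕ := max (max (max D4 D1) (max D6 D7)) (⌈Real.exp M₀⌉₊ + 1) with hD₀
  refine ⟨84 * K + 2, ForAllLarge.of_le D₀ ?_⟩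
  intro D _ χ hD hquad hprim hA s hs
  show ‖calM1 c' χ 1 1 s - eulerM1 χ‖ ≤ (84 * K + 2) * (alpha D * ell D)
  -- unpack the threshold
  have hD4 : D4 ≤ D := le_trans (le_trans (le_max_left _ _) (le_max_left _ _)) (le_trans (le_max_left _ _) hD)
  have hD1 : D1 ≤ D := le_trans (le_trans (le_max_right _ _) (le_max_left _ _)) (le_trans (le_max_left _ _) hD)
  have hD6 : D6 ≤ D := le_trans (le_trans (le_max_left _ _) (le_max_right _ _)) (le_trans (le_max_left _ _) hD)
  have hD7 : D7 ≤ D := le_trans (le_trans (le_max_right _ _) (le_max_right _ _)) (le_trans (le_max_left _ _) hD)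
  have hDM : ⌈Real.exp M₀⌉₊ + 1 ≤ D := le_trans (le_max_right _ _) hD
  have hM₀ℓ : M₀ ≤ ell D := le_ell_of_le hDM
  have hpos1 : 0 ≤ 100 * K * π := by positivity
  have hpos2 : 0 ≤ 8 * 10 ^ 14 * C4' / c ^ 16 := by
    have : 0 ≤ C4' := by linarith
    positivity
  have hpos3 : (0:ℝ) ≤ 10 ^ 14 * 28 := by positivity
  have hpos0 : 0 ≤ 7 * π * |c'| := by positivity
  have hDthr : ⌈Real.exp (7 * π * |c'| + 32)⌉₊ + 1 ≤ D := by
    refine le_trans ?_ hDM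
    gcongr
    rw [hM₀]; linarith
  obtain ⟨hℓ32, hb, h200, hα0⟩ := threshold c' hDthr
  have hℓ1 : 1 ≤ ell D := by linarith
  have hℓ2 : 2 ≤ ell D := by linarith
  have hαℓ : alpha D * ell D ≤ 1 / 200 := by linarith
  have hαℓ0 : 0 ≤ alpha D * ell D := by positivity
  have hD3 : 3 ≤ D := by
    by_contra h
    have : (D : ℝ) ≤ 2 := by exact_mod_cast (by omega : D ≤ 2)
    have : ell D ≤ Real.log 2 := by
      rw [ell]
      rcases Nat.eq_zero_or_pos D with h0 | hp
      · subst h0; simp; exact Real.log_nonneg (by norm_num)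
      · exact Real.log_le_log (by exact_mod_cast hp) this
    linarith [Real.log_two_lt_d9]
  have hD0 : 0 < D := by omega
  -- the three objects
  set S : Finset ℕ := (Finset.range D).filter Nat.Prime with hSdef
  set F : ℕ → ℂ := fun q => calM1Factor c' χ q 1 1 s with hFdef
  set M : ℕ → ℂ := fun q => if Nat.Coprime q D then
      (1 - χ (q : ZMod D) * (q : ℂ)⁻¹ ^ 2) / (1 - (q : ℂ)⁻¹ ^ 2) else 1 with hMdef
  -- per-prime estimate
  have hper : ∀ q ∈ S, ‖F q - M q‖ ≤ K * (alpha D * Real.log q / q) := by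
    intro q hq
    rw [hSdef, mem_filter, mem_range] at hq
    obtain ⟨hqD, hqp⟩ := hq
    have hq1 : (1 : ℝ) ≤ q := by exact_mod_cast hqp.one_lt.le
    have hlogq : Real.log q ≤ ell D := by
      rw [ell]; exact Real.log_le_log (by linarith) (by exact_mod_cast hqD.le)
    have hεq0 : 0 ≤ alpha D * Real.log q / q :=
      div_nonneg (mul_nonneg hα0.le (Real.log_natCast_nonneg q)) (Nat.cast_nonneg q)
    have hεq : alpha D * Real.log q / q ≤ 1 := by
      calc alpha D * Real.log q / q ≤ alpha D * Real.log q / 1 :=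
            div_le_div_of_nonneg_left (mul_nonneg hα0.le (Real.log_natCast_nonneg q)) one_pos hq1
        _ ≤ alpha D * ell D := by rw [div_one]; gcongr
        _ ≤ 1 := by linarith
    have hZF := H1 D χ hD1 hquad hprim hA q s hqp hqD hs
    have hZF' : ‖zetaFactor1 c' χ q s - (1 - (q : ℂ)⁻¹) / (1 - χ (q : ZMod D) * (q : ℂ)⁻¹)‖ ≤
        C1' * (alpha D * Real.log q / q) :=
      hZF.trans (mul_le_mul_of_nonneg_right (le_max_left _ _) hεq0)
    refine norm_calM1Factor_sub_main_le c' χ (h5 D χ) (h21a D χ) hqp hC1'1 hC2'1 hεq hα0.le hZF' ?_ ?_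
    · intro hcop
      exact (H6 D χ hD6 hquad hprim hA q s hqp hqD hcop hs).trans
        (mul_le_mul_of_nonneg_right ((le_max_left _ _).trans (le_max_left _ _)) hεq0)
    · intro hdvd
      exact (H7 D χ hD7 hquad hprim hA q s hqp hqD hdvd hs).trans
        (mul_le_mul_of_nonneg_right ((le_max_right _ _).trans (le_max_left _ _)) hεq0)
  -- the finite product
  have hMge : ∀ q ∈ S, 1 ≤ ‖M q‖ := fun q hq =>
    (norm_main_bounds χ hquad (mem_filter.mp hq).2).1
  have hexp3 : Real.exp 3 ≤ 21 := by
    have h := Real.exp_one_lt_d9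
    have e : Real.exp 3 = Real.exp 1 ^ 3 := by rw [← Real.exp_nat_mul]; norm_num
    rw [e]
    have h3 : Real.exp 1 ^ 3 < (2.7182818286 : ℝ) ^ 3 :=
      pow_lt_pow_left₀ h (Real.exp_pos 1).le (by norm_num)
    have : (2.7182818286 : ℝ) ^ 3 ≤ 21 := by norm_num
    linarith
  have hprodM : ‖∏ q ∈ S, M q‖ ≤ 21 := (norm_prod_main_le χ hquad).trans hexp3
  have hsumε : ∑ q ∈ S, K * (alpha D * Real.log q / q) ≤ 2 * K * (alpha D * ell D) := by
    rw [← mul_sum]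
    have : ∑ q ∈ S, alpha D * Real.log q / q = alpha D * ∑ q ∈ S, Real.log q / q := by
      rw [mul_sum]; refine sum_congr rfl fun q _ => by ring
    rw [this]
    have h2 := sum_log_div_le (D := D) hℓ2
    nlinarith [mul_le_mul_of_nonneg_left h2 hα0.le]
  have hKℓ : 100 * K * π ≤ ell D := by linarith
  obtain ⟨hx1, h84⟩ := absorb_pert (D := D) hK1 hℓ32 hKℓ
  have hpert : ‖∏ q ∈ S, F q - ∏ q ∈ S, M q‖ ≤ 84 * K * (alpha D * ell D) := by
    have h := norm_prod_sub_prod_le S F M (fun q => K * (alpha D * Real.log q / q)) hMge hper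
    have hx0 : 0 ≤ ∑ q ∈ S, K * (alpha D * Real.log q / q) := sum_nonneg fun q _ =>
      mul_nonneg (by linarith) (div_nonneg (mul_nonneg hα0.le (Real.log_natCast_nonneg q))
        (Nat.cast_nonneg q))
    have hexp : Real.exp (∑ q ∈ S, K * (alpha D * Real.log q / q)) - 1 ≤
        2 * (2 * K * (alpha D * ell D)) :=
      (Sieve.SquarefreeSums.exp_sub_one_le_two_mul hx0 (hsumε.trans hx1)).trans (by linarith)
    calc _ ≤ ‖∏ q ∈ S, M q‖ * (Real.exp (∑ q ∈ S, K * (alpha D * Real.log q / q)) - 1) := h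
      _ ≤ 21 * (2 * (2 * K * (alpha D * ell D))) := by
          gcongr
          exact sub_nonneg.mpr (Real.one_le_exp hx0)
      _ = 84 * K * (alpha D * ell D) := by ring
  have hprodF : ‖∏ q ∈ S, F q‖ ≤ 22 := by
    have : ∏ q ∈ S, F q = (∏ q ∈ S, F q - ∏ q ∈ S, M q) + ∏ q ∈ S, M q := by ring
    rw [this]
    calc _ ≤ ‖∏ q ∈ S, F q - ∏ q ∈ S, M q‖ + ‖∏ q ∈ S, M q‖ := norm_add_le _ _
      _ ≤ 84 * K * (alpha D * ell D) + 21 := by gcongr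
      _ ≤ 1 + 21 := by gcongr
      _ = 22 := by norm_num
  -- (A.4) at `d = l = 1`
  have hP2 : ((1 * 1 : ℕ) : ℝ) < Skeleton.P2 D ^ 2 := by
    have h := one_lt_P2 hℓ2
    push_cast
    nlinarith
  have hcop11 : Nat.Coprime (1 * 1) D := by rw [one_mul]; exact Nat.coprime_one_left D
  have h4 := H4 D χ hD4 hquad hprim hA 1 1 s one_pos one_pos hP2 hcop11 hs
  have hE4 : ‖calM1 c' χ 1 1 s - ∏ q ∈ S, F q‖ ≤ alpha D * ell D := by
    refine h4.trans ?_
    have hrpow0 : 0 ≤ (D : ℝ) ^ (-c) := Real.rpow_nonneg (Nat.cast_nonneg D) _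
    have hℓM : 8 * 10 ^ 14 * C4' / c ^ 16 ≤ ell D := by linarith
    calc C4 * (D : ℝ) ^ (-c) * ‖∏ q ∈ S, F q‖ ≤ C4' * (D : ℝ) ^ (-c) * 22 := by
          gcongr; exact le_max_left _ _
      _ ≤ alpha D * ell D := absorb_rpow hD0 hc hC4'1 hℓ1 hℓM
  -- the tail of the Euler product
  have hEtail : ‖eulerM1 χ - ∏ q ∈ S, M q‖ ≤ alpha D * ell D := by
    have h := norm_eulerM1_sub_prod_le χ (by omega : 2 ≤ D)
    have hℓbig : (10:ℝ) ^ 14 * 28 ≤ ell D := by linarith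
    have hD1r : (2 : ℝ) ≤ (D : ℝ) - 1 := by
      have : (3 : ℝ) ≤ D := by exact_mod_cast hD3
      linarith
    have hexp0 : 0 ≤ Real.exp (2 / ((D : ℝ) - 1)) - 1 :=
      sub_nonneg.mpr (Real.one_le_exp (by positivity))
    calc _ ≤ ‖∏ q ∈ S, M q‖ * (Real.exp (2 / ((D : ℝ) - 1)) - 1) := h
      _ ≤ 21 * (Real.exp (2 / ((D : ℝ) - 1)) - 1) := by gcongr
      _ ≤ alpha D * ell D := absorb_tail hD3 hℓ1 hℓbig
  -- assembly
  have e : calM1 c' χ 1 1 s - eulerM1 χ =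
      (calM1 c' χ 1 1 s - ∏ q ∈ S, F q) + (∏ q ∈ S, F q - ∏ q ∈ S, M q) -
        (eulerM1 χ - ∏ q ∈ S, M q) := by ring
  rw [e]
  calc _ ≤ ‖(calM1 c' χ 1 1 s - ∏ q ∈ S, F q) + (∏ q ∈ S, F q - ∏ q ∈ S, M q)‖ +
        ‖eulerM1 χ - ∏ q ∈ S, M q‖ := norm_sub_le _ _
    _ ≤ ‖calM1 c' χ 1 1 s - ∏ q ∈ S, F q‖ + ‖∏ q ∈ S, F q - ∏ q ∈ S, M q‖ +
        ‖eulerM1 χ - ∏ q ∈ S, M q‖ := by gcongr; exact norm_add_le _ _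
    _ ≤ alpha D * ell D + 84 * K * (alpha D * ell D) + alpha D * ell D := by gcongr
    _ = (84 * K + 2) * (alpha D * ell D) := by ring

/-- **`Z22:Lem15.2.pf` DISCHARGED** — the manuscript's deduction of Lemma 15.2 holds as typed:
`Typed.AppendixA2.Lem152_pf c′ = EqA4 → EqA5 → StepA_u021 → EqA6 → EqA7 → Lemma152I` (L4-t3's statement of
record `Typed.Section15C.Lemma152I c′`).
[cite: Zhang2022LandauSiegel, App. A pp. 103–104 (proof of Lemma 15.2)] -/
theorem lem152_pf_holds (c' : ℝ) : Typed.AppendixA2.Lem152_pf c' := by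
  intro h4 h5 h21 h6 h7
  refine lemma152_core c' h4 (fun D _ χ q r hq hr => ?_) (fun D _ χ q hq => ?_) h21.2 h6 h7
  · have h := h5 D χ q 1 1 r hq one_pos one_pos hr
    rwa [if_pos (Nat.coprime_one_right q)] at h
  · have h := h21.1 D χ q 1 hq le_rfl
    rwa [pow_one] at h

variable (c' : ℝ) in
/-- `Lem152_pf` — `_holds` alias of `lem152_pf_holds` above under the fact's exact name, stated under the
prover's own binders as section variables (appended 2026-08-28, D-0026 bookkeeping: the proof term is the
existing theorem of this file; no statement, definition or attribute is edited; no new named fact; the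
ledger's debt table listed the fact unproved). [cite: Zhang2022LandauSiegel, App. A pp. 103–104 (proof of Lemma 15.2)] -/
theorem _root_.Literature.NumberTheory.LFunctions.Zhang2022.Typed.AppendixA2.Lem152_pf_holds :
    _root_.Literature.NumberTheory.LFunctions.Zhang2022.Typed.AppendixA2.Lem152_pf c' :=
  _root_.Literature.NumberTheory.LFunctions.Zhang2022.AppendixALocal.lem152_pf_holds (c' := c')

/-- **Lemma 15.2 from (A.4) alone**: the other inputs of `Lem152_pf` are theorems of the tree —
(A.5) (`Typed.AppendixA1.eqA_5_holds`, L4-t8), u021a (`Typed.AppendixA2.stepA_u021a_holds`, L4-t9),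
u021b and (A.6)/(A.7) (`AppendixALemma152StepsS`). The remaining hypothesis (A.4) is the manuscript's
analytic claim (Euler product of `ℳ₁` with tail `1 + O(D^{−c})`).
[cite: Zhang2022LandauSiegel, Lemma 15.2 p. 87; App. A pp. 103–104] -/
theorem lemma152_of_eqA4 (c' : ℝ) (h4 : Typed.AppendixA2.EqA4 c') :
    Typed.Section15C.Lemma152I c' := by
  refine lemma152_core c' h4 (fun D _ χ q r hq hr => ?_) (fun D _ χ q hq => ?_)
    (stepA_u021b_holds c') (eqA6_holds c') (eqA7_holds c')
  · exact (Typed.AppendixA1.eqA_5_holds c' D χ q 1 1 r hq le_rfl le_rfl hr).1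
      (Nat.coprime_one_right q)
  · have h := Typed.AppendixA2.stepA_u021a_holds c' D χ q 1 hq le_rfl
    rwa [pow_one] at h

end Literature.NumberTheory.LFunctions.Zhang2022.AppendixALocal
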